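import Summits.BirchSwinnertonDyer.BirchSwinnertonDyer.Theorems.AlignedTransportAtTwoMainConjectureOfRankZeroBSDAtTwoFineRoadInfRes
import Literature.NumberTheory.EllipticCurves.GreenbergSelmer
import Literature.NumberTheory.GaloisRepresentations.FrobeniusGeneration
import Literature.NumberTheory.GaloisRepresentations.CyclotomicCharacterReductionProofs
import Literature.NumberTheory.GaloisRepresentations.DecompositionGroupOfCompletion
import Mathlib.NumberTheory.Multiplicity
import Mathlib.LinearAlgebra.FreeModule.IdealQuotient
import Mathlib.FieldTheory.Finite.Basic
import HarnessLib

/-!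
# Road (b″) netted, local brick (iii): ODD PLACES SPLIT — every place `v ∤ 2` of the cyclotomic
# `ℤ₂`-extension `K_∞^{cyc}` splits completely in Kato's tower `K(μ_{2^∞})` (kernel statement
# `ker κ ⊓ D_v ≤ ker χ₂`, every number field `K`), and the local terms of the descent at odd places vanish

Cell `bsd-f1-sign2`, WIDTH-5 attach seat `bsd-line-att-p4` (gen 4) on line `birth` of crux C2
stmt-BirchSwinnertonDyer-22298 `MainConjectureOfRankZeroBSDAtTwo`; a `--supports 22298 --as helper` file, sequel of
`…FineRoadInfResRel` / `…FineRoadInfResSurj` (att-p4 g3). HONEST FRAMING: THEOREMS ONLY — no definition, no named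
fact, no `sorry`; BSD is NOT proved by any of this.

WHY. After att-p4 g3 (`…FineRoadInfResSharp`/`…InfResSurj`: on the seed cell
`res : H¹(ℚ_∞, E[2^∞]) ≅ H¹(ℚ(ζ_{2^∞}), E[2^∞])^Δ`) the cokernels of the Selmer-level restrictions
`res : Sel^{rel ∞}(K_∞) → Sel(K(μ_{2^∞}))^Δ`, `res₀ : Sel₀^{rel ∞}(K_∞) → Sel₀(K(μ_{2^∞}))^Δ` of ARCH-NETTING (ii)
(= `ker fd^{rel}`, `ker fyʳ` of the netted Kato data, dually) are PURELY LOCAL. This file kills the local terms at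
every ODD place, for every number field: `K(μ_{2^∞}) = K_∞^{cyc}(μ₄)` and a place `w ∤ 2` of `K_∞^{cyc}` SPLITS in it,
because `Gal(K_v(μ_{2^∞})/K_v) = χ₂(D_v) = \overline{⟨N v⟩} ≅ ℤ₂` is torsion-free while
`Gal(K(μ_{2^∞})/K_∞^{cyc}) = χ₂(ker κ) ⊆ μ(ℤ₂) = {±1}`.

* §1 `not_two_pow_dvd_pow_add_one` — elementary: for odd `q` and `2^k > q + 1` (`k ≥ 2`), `2^k ∤ qⁿ + 1` (n even: an
  odd square is `≡ 1 (mod 4)`; n odd: `v₂(qⁿ + 1) = v₂(q + 1)`, Mathlib `not_dvd_geom_sum₂`).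
* §2 `eq_one_or_eq_neg_one_of_mem_torsion` — `μ(ℤ₂) ⊆ {±1}` (tree `PadicInt.torsion_units_le_rootsOfUnity`,
  `torsionOrder 2 = 2`); `coe_modNCyclotomicCharacter_two_pow` (`χ_{2^k} = χ₂ mod 2^k`);
  `isOpen_ker_modNCyclotomicCharacter`.
* §3 **`cyclotomicCharacter_ne_neg_one_of_mem_decomp`**: for `v ∤ 2` and `d ∈ D_v`, `χ₂(d) ≠ -1`. Proof: write
  `d = φⁿ·i·u` modulo the open `U = ker χ_{2^k}` with `φ` an arithmetic Frobenius and `i ∈ I_{𝔓₀}` (tree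
  `exists_eq_frobenius_pow_mul_of_mem_decompositionSubgroup`); `χ_{2^k}(i) = 1`, `χ_{2^k}(φ) = N v` (tree
  `modNCyclotomicCharacter_eq_one_of_mem_inertia` / `…_eq_residueCard_of_isArithFrobAt`), so `χ₂(d) = -1` would give
  `(N v)ⁿ ≡ -1 (mod 2^k)` for `2^k > N v + 1` — excluded by §1 (`N v` is odd for `v ∤ 2`).
  **`kerSubgroup_inf_decomp_le_ker_cyclotomicCharacter`** / **`kerSubgroup_inf_decomp_eq`**: for the cyclotomic
  `ℤ₂`-extension `κ`, `ker κ ⊓ D_v = ker χ₂ ⊓ D_v` (`χ₂(ker κ) ⊆ μ(ℤ₂)`, §2); locally: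
  `comap_absGaloisRestrict_kerSubgroup_eq` (`res_v⁻¹(ker κ) = res_v⁻¹(ker χ₂)` in `Γ_{K_v}`: `K_{∞,w} ∋ μ_{2^∞}`).
* Sequel `…FineRoadOddSplitDescent`: the consequences for `H¹` — at odd places the local conditions (locally trivial /
  classical Kummer) of a class over `K_∞^{cyc}` are detected by its restriction to `K(μ_{2^∞})`, so the cokernels of
  `res`, `res₀` are supported at the prime above `2` ONLY (brick (ii): Coates–Greenberg / Imai, next).

References: J.-P. Serre, *Corps locaux* IV §4 and *Abelian ℓ-adic representations* I-1.2 (`χ_ℓ(Frob_v) = Nv`,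
unramified away from `ℓ`); J. Neukirch, *ANT* II (9.6), I (9.4); L. Washington, *Cyclotomic Fields* §13.1;
R. Greenberg, LNM 1716 (1999), §3 (restriction maps `s_n`, `h_n`, `g_n`) and §4 p. 106; K. Kato, Astérisque 295 §17.13.
-/

set_option autoImplicit false
-- the Theorems namespace of this sub repeats the summit name by design (D-0017 nested layout)
set_option linter.dupNamespace false

noncomputable section

open scoped Classical

namespace Summit.BirchSwinnertonDyer.BirchSwinnertonDyer.Theorems.AlignedTransportAtTwoFineRoad.OddSplit

open WeierstrassCurve NumberField IsDedekindDomain Field Literature.NumberTheory.EllipticCurves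
  Literature.NumberTheory.EllipticCurves.GreenbergSelmer Literature.NumberTheory.GaloisRepresentations ZpExtension

universe u

/-! ## §1 Elementary: `2^k ∤ qⁿ + 1` for odd `q` once `2^k > q + 1` -/

section Elementary

/-- **`2^k ∤ qⁿ + 1`** for an odd natural number `q`, any `n`, and `k ≥ 2` with `q + 1 < 2^k`: if `n` is even, `qⁿ`
is an odd square, `≡ 1 (mod 4)`, so `4 ∤ qⁿ + 1`; if `n` is odd, `qⁿ + 1 = (q + 1)·S` with
`S = Σ qⁱ(−1)^{n−1−i}` ODD (Mathlib `not_dvd_geom_sum₂`), so `2^k ∣ qⁿ + 1` forces `2^k ∣ q + 1 < 2^k`.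
(This is the statement «`−1 ∉ \overline{⟨q⟩} ⊂ ℤ₂ˣ`»: the closure of `⟨q⟩` is a quotient of `ℤ₂`, torsion-free.)
[cite: Serre1973, Ch. II §3.2 Prop. 8] -/
theorem not_two_pow_dvd_pow_add_one {q n k : ℕ} (hq : Odd q) (hk : 2 ≤ k) (hqk : q + 1 < 2 ^ k) :
    ¬ 2 ^ k ∣ q ^ n + 1 := by
  intro h
  rcases Nat.even_or_odd n with hn | hn
  · -- `n` even: `qⁿ + 1 ≡ 2 (mod 4)`
    obtain ⟨m, rfl⟩ := hn
    obtain ⟨t, ht⟩ : Odd (q ^ m) := hq.pow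
    have h4 : 2 ^ 2 ∣ q ^ (m + m) + 1 := (pow_dvd_pow 2 hk).trans h
    rw [pow_add, ht, show (2 * t + 1) * (2 * t + 1) + 1 = 4 * (t * t + t) + 2 by ring] at h4
    norm_num at h4
    omega
  · -- `n` odd: `qⁿ + 1 = S · (q + 1)` with `S` odd
    have hxy : (2 : ℤ) ∣ (q : ℤ) - (-1) := by
      rw [sub_neg_eq_add]
      exact_mod_cast (hq.add_odd odd_one).two_dvd
    have hx : ¬ (2 : ℤ) ∣ (q : ℤ) := by exact_mod_cast hq.not_two_dvd_nat
    have hn2 : ¬ (2 : ℤ) ∣ (n : ℤ) := by exact_mod_cast hn.not_two_dvd_nat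
    have hS := not_dvd_geom_sum₂ Int.prime_two hxy hx hn2
    have hfac : (∑ i ∈ Finset.range n, (q : ℤ) ^ i * (-1) ^ (n - 1 - i)) * ((q : ℤ) + 1) =
        (q : ℤ) ^ n + 1 := by
      have e := geom_sum₂_mul (q : ℤ) (-1) n
      rwa [sub_neg_eq_add, hn.neg_one_pow, sub_neg_eq_add] at e
    have hZ : (2 : ℤ) ^ k ∣ (q : ℤ) ^ n + 1 := by exact_mod_cast h
    rw [← hfac] at hZ
    have hq1 : (2 : ℤ) ^ k ∣ (q : ℤ) + 1 := Int.prime_two.pow_dvd_of_dvd_mul_left k hS hZ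
    have hq1' : 2 ^ k ∣ q + 1 := by exact_mod_cast hq1
    exact absurd (Nat.le_of_dvd (Nat.succ_pos q) hq1') (not_le.mpr hqk)

end Elementary

/-! ## §2 `μ(ℤ₂) ⊆ {±1}`; the mod `2^k` cyclotomic character; its kernel is open -/

section TorsionTwo

/-- **The torsion of `ℤ₂ˣ` is `{±1}`** (as an inclusion): a unit of finite order is a square root of unity
(`PadicInt.torsion_units_le_rootsOfUnity`, `#μ(ℤ₂) = φ(4) = 2`), and `ℤ₂` is a domain.
[cite: Serre1973, Ch. II §3.1 Prop. 7, §3.2 Prop. 8] -/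
theorem eq_one_or_eq_neg_one_of_mem_torsion {u : ℤ_[2]ˣ} (hu : u ∈ CommGroup.torsion ℤ_[2]ˣ) :
    u = 1 ∨ u = -1 := by
  have h := PadicInt.torsion_units_le_rootsOfUnity (p := 2) hu
  have ht : torsionOrder 2 = 2 := by
    show Nat.totient (2 ^ (if (2 : ℕ) = 2 then 2 else 1)) = 2
    rw [if_pos rfl, Nat.totient_prime_pow Nat.prime_two two_pos]
    norm_num
  rw [ht, mem_rootsOfUnity] at h
  have h' : ((u : ℤ_[2]ˣ) : ℤ_[2]) ^ 2 = 1 := by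
    rw [← Units.val_pow_eq_pow_val, h, Units.val_one]
  rcases sq_eq_one_iff.mp h' with h1 | h1
  · exact Or.inl (Units.ext h1)
  · exact Or.inr (Units.ext (by rw [h1, Units.val_neg, Units.val_one]))

variable (K : Type) [Field K] [NumberField K]

/-- `χ_{2^k} = χ₂ mod 2^k`: the mod `2^k` cyclotomic character is the reduction of the `2`-adic one (both are pinned
down by the action on one primitive `2^k`-th root of unity; `GaloisRep.cyclotomicCharacter_spec`,
`modNCyclotomicCharacter_eq_of_smul_eq_pow`). [folklore] -/
theorem coe_modNCyclotomicCharacter_two_pow (k : ℕ) (σ : absoluteGaloisGroup K) :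
    (modNCyclotomicCharacter K (2 ^ k) σ : ZMod (2 ^ k)) =
      PadicInt.toZModPow k ((GaloisRep.cyclotomicCharacter K 2 σ : ℤ_[2]ˣ) : ℤ_[2]) := by
  haveI : NeZero ((2 ^ k : ℕ) : AlgebraicClosure K) :=
    NeZero.nat_of_injective (algebraMap K (AlgebraicClosure K)).injective
  obtain ⟨ζ, hζ⟩ := HasEnoughRootsOfUnity.exists_primitiveRoot (AlgebraicClosure K) (2 ^ k)
  have h1 := GaloisRep.cyclotomicCharacter_spec K 2 (k := k) σ ζ hζ.pow_eq_one
  rw [modNCyclotomicCharacter_eq_of_smul_eq_pow K (2 ^ k) hζ σ h1, ZMod.natCast_zmod_val]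

/-- The kernel of the mod `N` cyclotomic character is an OPEN subgroup of `Γ_K` (`χ_N` is locally constant,
`modNCyclotomicCharacter_eventually_eq_one`). [folklore] -/
theorem isOpen_ker_modNCyclotomicCharacter (N : ℕ) [NeZero N] :
    IsOpen (((modNCyclotomicCharacter K N).ker : Subgroup (absoluteGaloisGroup K)) :
      Set (absoluteGaloisGroup K)) :=
  Subgroup.isOpen_of_mem_nhds _ (g := 1) (modNCyclotomicCharacter_eventually_eq_one K N)

end TorsionTwo

/-! ## §3 Odd places split in `K(μ_{2^∞}) / K_∞^{cyc}` -/

section Split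

variable {K : Type} [Field K] [NumberField K]

/-- The residue cardinality `N v` of a finite place `v ∤ 2` is ODD (the residue field has characteristic `ℓ ≠ 2`,
`N v = ℓ^f`). [cite: NeukirchANT1999, Ch. I §8 Prop. (8.2)] -/
theorem odd_residueCard {v : HeightOneSpectrum (𝓞 K)} (hv : ((2 : ℕ) : 𝓞 K) ∉ v.asIdeal) :
    Odd v.residueCard := by
  classical
  haveI : Finite (𝓞 K ⧸ v.asIdeal) := v.asIdeal.finiteQuotientOfFreeOfNeBot v.ne_bot
  letI : Fintype (𝓞 K ⧸ v.asIdeal) := Fintype.ofFinite _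
  haveI := v.isMaximal
  letI : Field (𝓞 K ⧸ v.asIdeal) := Ideal.Quotient.field v.asIdeal
  obtain ⟨ℓ, hchar, f, hℓ, hcard⟩ := FiniteField.card' (𝓞 K ⧸ v.asIdeal)
  have hℓ2 : ℓ ≠ 2 := by
    rintro rfl
    apply hv
    haveI := hchar
    rw [← Ideal.Quotient.eq_zero_iff_mem, map_natCast]
    exact CharP.cast_eq_zero _ 2
  have hq : v.residueCard = ℓ ^ (f : ℕ) := by
    rw [HeightOneSpectrum.residueCard_eq_card_quotient, Nat.card_eq_fintype_card, hcard]
  rw [hq]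
  exact (hℓ.odd_of_ne_two hℓ2).pow

/-- **`χ₂(d) ≠ −1` on the decomposition group of an odd place.** For a finite place `v ∤ 2` of a number field
`K` and `d ∈ D_v` (the decomposition group of the prime `𝔓₀` above `v` cut out by the chosen embedding), the
`2`-adic cyclotomic character of `d` is not `−1`: modulo the open subgroup `ker χ_{2^k}`, `d = φⁿ·i·u` with `φ`
an arithmetic Frobenius at `𝔓₀` and `i ∈ I_{𝔓₀}` (`exists_eq_frobenius_pow_mul_of_mem_decompositionSubgroup`),
and `χ_{2^k}(φ) = N v`, `χ_{2^k}(i) = 1`; so `χ₂(d) = −1` gives `(N v)ⁿ ≡ −1 (mod 2^k)` for every `k`, absurd for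
`2^k > N v + 1` (§1). I.e. `−1 ∉ χ₂(D_v) = \overline{⟨N v⟩}`: `Gal(K_v(μ_{2^∞})/K_v) ≅ ℤ₂` is torsion-free.
[cite: SerreAbelianLadic1968, Ch. I §1.2 (Example: the cyclotomic character)] [cite: NeukirchANT1999, Ch. I §9 Prop. (9.4)–(9.6)] -/
theorem cyclotomicCharacter_ne_neg_one_of_mem_decomp {v : HeightOneSpectrum (𝓞 K)}
    (hv : ((2 : ℕ) : 𝓞 K) ∉ v.asIdeal) {d : absoluteGaloisGroup K} (hd : d ∈ decomp v) :
    GaloisRep.cyclotomicCharacter K 2 d ≠ -1 := by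
  intro hneg
  -- the prime `𝔓₀` above `v` of the chosen embedding and an arithmetic Frobenius at it
  have h𝔓 : adicCompletionPrime K v ∈ v.primesAbove := adicCompletionPrime_mem_primesAbove K v
  haveI : (adicCompletionPrime K v).IsPrime := h𝔓.1
  obtain ⟨φ, hφ⟩ :=
    HeightOneSpectrum.exists_isArithFrobAt_of_mem_primesAbove_holds (K := K) (v := v) h𝔓
  have hdD : d ∈ (adicCompletionPrime K v).decompositionSubgroup (absoluteGaloisGroup K) := by
    rw [decompositionSubgroup_adicCompletionPrime_eq_range]
    exact hd
  -- the level `2^k > N v + 1`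
  set q : ℕ := v.residueCard with hq
  set k : ℕ := q + 1 with hk
  have hqk : q + 1 < 2 ^ k := Nat.lt_two_pow_self
  have hk2 : 2 ≤ k := by have := v.one_lt_residueCard; omega
  have h2v : ((2 ^ k : ℕ) : 𝓞 K) ∉ v.asIdeal := by
    intro hmem
    apply hv
    rw [Nat.cast_pow] at hmem
    exact v.isPrime.mem_of_pow_mem k hmem
  have h2𝔓 : ((2 ^ k : ℕ) : absIntegers (𝓞 K) K) ∉ adicCompletionPrime K v :=
    absIntegers.natCast_notMem_of_mem_primesAbove h2v h𝔓
  -- `d = φⁿ · i · u` modulo `U = ker χ_{2^k}`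
  obtain ⟨n, i, u, hi, hu, hdeq⟩ := exists_eq_frobenius_pow_mul_of_mem_decompositionSubgroup h𝔓 hφ
    (isOpen_ker_modNCyclotomicCharacter K (2 ^ k)) hdD
  have hχi : modNCyclotomicCharacter K (2 ^ k) i = 1 := modNCyclotomicCharacter_eq_one_of_mem_inertia h2𝔓 hi
  have hχu : modNCyclotomicCharacter K (2 ^ k) u = 1 := (MonoidHom.mem_ker).mp hu
  have hχφ : (modNCyclotomicCharacter K (2 ^ k) φ : ZMod (2 ^ k)) = q :=
    modNCyclotomicCharacter_eq_residueCard_of_isArithFrobAt h𝔓 h2𝔓 hφ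
  have hχd : (modNCyclotomicCharacter K (2 ^ k) d : ZMod (2 ^ k)) = -1 := by
    rw [coe_modNCyclotomicCharacter_two_pow, hneg, Units.val_neg, Units.val_one, map_neg, map_one]
  have hχd' : modNCyclotomicCharacter K (2 ^ k) d = modNCyclotomicCharacter K (2 ^ k) φ ^ n := by
    rw [hdeq, map_mul, map_mul, map_pow, hχi, hχu, mul_one, mul_one]
  have key : (q : ZMod (2 ^ k)) ^ n = -1 := by
    rw [← hχφ, ← Units.val_pow_eq_pow_val, ← hχd', hχd]
  -- hence `2^k ∣ qⁿ + 1`, contradicting §1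
  have hdvd : 2 ^ k ∣ q ^ n + 1 := by
    rw [← ZMod.natCast_eq_zero_iff, Nat.cast_add, Nat.cast_pow, Nat.cast_one, key, neg_add_cancel]
  exact not_two_pow_dvd_pow_add_one (odd_residueCard hv) hk2 hqk hdvd

variable (κ : ZpExtension K 2)

/-- **ODD PLACES SPLIT in `K(μ_{2^∞}) / K_∞^{cyc}`** (kernel statement): for the CYCLOTOMIC `ℤ₂`-extension `κ` of a
number field `K` and every finite place `v ∤ 2`, `ker κ ⊓ D_v ≤ ker χ₂` — an element of the decomposition group
at `v` fixing `K_∞^{cyc} = K̄^{ker κ}` fixes `K(μ_{2^∞}) = K̄^{ker χ₂}`: `χ₂(ker κ) ⊆ μ(ℤ₂) = {±1}` (`κ.IsCyclotomic`,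
§2) and `χ₂ ≠ −1` on `D_v` (`cyclotomicCharacter_ne_neg_one_of_mem_decomp`). In words: the decomposition group of
`Δ = Gal(K(μ_{2^∞})/K_∞^{cyc})` at every place above an odd `v` is trivial (`Δ_w = 1`).
[cite: Washington1997, §13.1] [cite: SerreAbelianLadic1968, Ch. I §1.2 (Example: the cyclotomic character)] -/
theorem kerSubgroup_inf_decomp_le_ker_cyclotomicCharacter (hκ : κ.IsCyclotomic) {v : HeightOneSpectrum (𝓞 K)}
    (hv : ((2 : ℕ) : 𝓞 K) ∉ v.asIdeal) :
    κ.kerSubgroup ⊓ decomp v ≤ (GaloisRep.cyclotomicCharacter K 2).toMonoidHom.ker := by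
  intro d hd
  obtain ⟨hdκ, hdD⟩ := Subgroup.mem_inf.mp hd
  rw [MonoidHom.mem_ker]
  have htors : GaloisRep.cyclotomicCharacter K 2 d ∈ CommGroup.torsion ℤ_[2]ˣ := by
    rw [show κ.kerSubgroup = _ from hκ] at hdκ
    exact Subgroup.mem_comap.mp hdκ
  rcases eq_one_or_eq_neg_one_of_mem_torsion htors with h1 | hneg
  · exact h1
  · exact absurd hneg (cyclotomicCharacter_ne_neg_one_of_mem_decomp hv hdD)

/-- **`ker κ ⊓ D_v = ker χ₂ ⊓ D_v` for `v ∤ 2`** (cyclotomic `κ`): the decomposition groups of `K_∞^{cyc}` and of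
`K(μ_{2^∞})` at the chosen place above an odd `v` COINCIDE (`ker χ₂ ≤ ker κ`, `InfRes.ker_cyclotomicCharacter_le_kerSubgroup`,
and the previous theorem). [cite: Washington1997, §13.1] -/
theorem kerSubgroup_inf_decomp_eq (hκ : κ.IsCyclotomic) {v : HeightOneSpectrum (𝓞 K)}
    (hv : ((2 : ℕ) : 𝓞 K) ∉ v.asIdeal) :
    κ.kerSubgroup ⊓ decomp v = (GaloisRep.cyclotomicCharacter K 2).toMonoidHom.ker ⊓ decomp v :=
  le_antisymm (le_inf (kerSubgroup_inf_decomp_le_ker_cyclotomicCharacter κ hκ hv) inf_le_right)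
    (inf_le_inf_right _ (InfRes.ker_cyclotomicCharacter_le_kerSubgroup κ hκ))

/-- **Local form: `res_v⁻¹(ker κ) = res_v⁻¹(ker χ₂)` in `Γ_{K_v}`** for `v ∤ 2` (cyclotomic `κ`): the absolute Galois
groups of `K_v · K_∞^{cyc}` and of `K_v(μ_{2^∞})` inside `Γ_{K_v}` coincide — `K_{∞,w} ⊇ μ_{2^∞}` for every place
`w ∣ v` of `K_∞^{cyc}`, i.e. `w` splits completely in `K(μ_{2^∞})`. (`decomp v` is the image of
`res_v = absGaloisRestrict K K_v`.) [cite: Washington1997, §13.1] [cite: NeukirchANT1999, Ch. II §9 Prop. (9.6)] -/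
theorem comap_absGaloisRestrict_kerSubgroup_eq (hκ : κ.IsCyclotomic) {v : HeightOneSpectrum (𝓞 K)}
    (hv : ((2 : ℕ) : 𝓞 K) ∉ v.asIdeal) :
    κ.kerSubgroup.comap (absGaloisRestrict K (v.adicCompletion K)).toMonoidHom =
      (GaloisRep.cyclotomicCharacter K 2).toMonoidHom.ker.comap
        (absGaloisRestrict K (v.adicCompletion K)).toMonoidHom := by
  ext τ
  simp only [Subgroup.mem_comap]
  exact ⟨fun h ↦ kerSubgroup_inf_decomp_le_ker_cyclotomicCharacter κ hκ hv ⟨h, ⟨τ, rfl⟩⟩,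
    fun h ↦ InfRes.ker_cyclotomicCharacter_le_kerSubgroup κ hκ h⟩

end Split

end Summit.BirchSwinnertonDyer.BirchSwinnertonDyer.Theorems.AlignedTransportAtTwoFineRoad.OddSplit

end
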